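import Mathlib
import Summits.MatrixMultiplication.MatrixMultiplication.Theorems.SubgroupIdentityDesigns.Negative.BorelGhost

/-!
# Fibre ghosts: the general exact FAIL certificate for level-one identity designs in `GL₂(𝔽_p)`
(negative lemma for the crux `SubgroupIdentityDesigns`, stmt-MatrixMultiplication-14079; cell B2b-5,
gen 7 — report `run/shared/lean/b2b/levelgraded-cu/ORACLE-g7.md` §G7-1)

A level-one function on `M₂(𝔽_p)` is `f_c = Σ_{rk M ≤ 1} c_M ψ(tr(M s))`.  A non-zero matrix of rank `≤ 1`
is an outer product `M = a bᵀ` (`exists_vecMulVec_of_rank_le_one`, here for `2 × 2` from the singular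
relation `M₀₀M₁₁ = M₀₁M₁₀`), and then `tr(M s) = b · (s a)` depends on `s` only through the vector
`s a` (`trace_vecMulVec_mul`).  Hence every FIBRE GHOST — a weight `w` on `M₂(𝔽_p)` all of whose
FIBRE SUMS `Σ_{s : s v = x} w(s)` (`v ≠ 0`; written out as `Σ_s [s v = x] w(s)`, no auxiliary
definitions) vanish — annihilates every level-one function
(`fibreGhost_mode_eq_zero`, `fibreGhost_sum_eq_zero`), while a level-one identity test on a set `S`
(`f_c(1) = 1`, `f_c = 0` on `S ∖ {1}`) paired with a ghost supported in `S` returns `w(1)`.  So: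
* `no_idTest_of_fibreGhost` — a fibre ghost supported in `S ⊆ M₂(𝔽_p)` with `w(1) ≠ 0` kills every
  level-one identity test on `S`;
* `no_levelOne_design_of_fibreGhost` — the same in the literal shape of the crux's design clause at
  `(m,k) = (2,1)` for subgroups `H₁, H₂, H₃ ≤ GL₂(𝔽_p)` whose triple products carry the ghost.
This is the SOUNDNESS THEOREM of the cell's uniform certificate format: the unipotent-coset ghosts of
Theorem H (`BorelGhost`), the torus-coset / line-pair ghosts and the quotient-sieve ghosts of the gen-7
census are all fibre ghosts, and each census FAIL verdict is an explicit integer `w` checked against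
exactly these hypotheses.  (By finite-dimensional duality the converse holds too — no fibre ghost with
`w(1) ≠ 0` in `S` iff a design exists — which is what the census decides; only soundness is formalised.)
Sorry-free; axioms `propext`, `Classical.choice`, `Quot.sound`.  VALUE = certificate soundness for the
finite frontier of the crux, NOT summit progress.
-/

set_option linter.dupNamespace false

noncomputable section

open scoped BigOperators Classical
open Matrix
open Summit.MatrixMultiplication.MatrixMultiplication.Theorems.LieRankDesigns.Negative (GLm Mat)

namespace Summit.MatrixMultiplication.MatrixMultiplication.Theorems.SubgroupIdentityDesigns.Negative

variable {p : ℕ} [Fact p.Prime]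

section FibreGhost

/-! A weight `w : M₂(𝔽_p) → ℂ` is a FIBRE GHOST when every FIBRE SUM
`Σ_{s : s v = x} w(s) = Σ_s [s v = x] w(s)` over a non-zero direction `v` vanishes; we spell the
fibre sums out as `∑ s, if s.mulVec v = x then w s else 0` (no auxiliary definitions). -/

/-- Summing a weight against a function of `s v`, fibre by fibre. -/
theorem sum_mul_apply_mulVec (w : CMat p 2 → ℂ) (v : Fin 2 → ZMod p) (F : (Fin 2 → ZMod p) → ℂ) :
    ∑ s : CMat p 2, w s * F (s.mulVec v) =
      ∑ x : Fin 2 → ZMod p, F x * ∑ s : CMat p 2, (if s.mulVec v = x then w s else 0) := by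
  simp_rw [Finset.mul_sum]
  rw [Finset.sum_comm]
  refine Finset.sum_congr rfl fun s _ => ?_
  rw [Finset.sum_eq_single (s.mulVec v)]
  · rw [if_pos rfl, mul_comm]
  · intro x _ hx
    rw [if_neg (Ne.symm hx), mul_zero]
  · intro h
    exact absurd (Finset.mem_univ _) h

/-- The total mass of a fibre ghost is zero. -/
theorem fibreGhost_total_eq_zero {w : CMat p 2 → ℂ}
    (hw : ∀ v : Fin 2 → ZMod p, v ≠ 0 → ∀ x : Fin 2 → ZMod p,
      (∑ s : CMat p 2, (if s.mulVec v = x then w s else 0)) = 0) :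
    ∑ s : CMat p 2, w s = 0 := by
  have hv : (fun i : Fin 2 => (1 : ZMod p)) ≠ 0 := by
    intro h
    have := congrFun h 0
    simp at this
  have h := sum_mul_apply_mulVec w (fun _ => (1 : ZMod p)) (fun _ => 1)
  simp_rw [mul_one] at h
  rw [h]
  refine Finset.sum_eq_zero fun x _ => ?_
  rw [hw _ hv x, mul_zero]

/-- `tr(a bᵀ · s) = b · (s a)`. -/
theorem trace_vecMulVec_mul (a b : Fin 2 → ZMod p) (s : CMat p 2) :
    Matrix.trace (Matrix.vecMulVec a b * s) = b ⬝ᵥ s.mulVec a := by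
  simp [Matrix.trace, Matrix.mul_apply, Matrix.vecMulVec_apply, dotProduct, Matrix.mulVec,
    Fin.sum_univ_two]
  ring

/-- A non-zero `2 × 2` matrix of rank `≤ 1` is an outer product `a bᵀ` with `a ≠ 0`. [folklore] -/
theorem exists_vecMulVec_of_rank_le_one (M : CMat p 2) (hM : M.rank ≤ 1) (hM0 : M ≠ 0) :
    ∃ a b : Fin 2 → ZMod p, a ≠ 0 ∧ M = Matrix.vecMulVec a b := by
  have hrel := entries_of_rank_le_one M hM
  by_cases h00 : M 0 0 = 0
  · by_cases h10 : M 1 0 = 0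
    · -- first column zero: `M = (M₀₁, M₁₁) (0,1)ᵀ`
      refine ⟨![M 0 1, M 1 1], ![0, 1], ?_, ?_⟩
      · intro h
        apply hM0
        have h0 : M 0 1 = 0 := by simpa using congrFun h 0
        have h1 : M 1 1 = 0 := by simpa using congrFun h 1
        ext i j
        fin_cases i <;> fin_cases j <;> simp [h00, h10, h0, h1]
      · ext i j
        fin_cases i <;> fin_cases j <;> simp [Matrix.vecMulVec_apply, h00, h10]
    · -- `M₀₀ = 0`, `M₁₀ ≠ 0`: then `M₀₁ = 0` and `M = (0, M₁₀) (1, M₁₁/M₁₀)ᵀ`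
      have h01 : M 0 1 = 0 := by
        rw [h00, zero_mul] at hrel
        rcases mul_eq_zero.mp hrel.symm with h | h
        · exact h
        · exact absurd h h10
      refine ⟨![M 0 0, M 1 0], ![1, M 1 1 * (M 1 0)⁻¹], ?_, ?_⟩
      · intro h
        exact h10 (by simpa using congrFun h 1)
      · ext i j
        fin_cases i <;> fin_cases j <;> simp [Matrix.vecMulVec_apply, h00, h01]
        field_simp
  · -- `M₀₀ ≠ 0`: `M = (M₀₀, M₁₀) (1, M₀₁/M₀₀)ᵀ`
    refine ⟨![M 0 0, M 1 0], ![1, M 0 1 * (M 0 0)⁻¹], ?_, ?_⟩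
    · intro h
      exact h00 (by simpa using congrFun h 0)
    · ext i j
      fin_cases i <;> fin_cases j <;> simp [Matrix.vecMulVec_apply]
      · field_simp
      · -- `M₁₁ = M₁₀ M₀₁ / M₀₀`
        have : M 1 1 = M 0 1 * M 1 0 * (M 0 0)⁻¹ := by
          rw [← hrel]; field_simp
        rw [this]; ring

/-- **Fibre ghosts annihilate level-one modes**: `Σ_s w(s) ψ(tr(M s)) = 0` for every `M` of rank `≤ 1`. -/
theorem fibreGhost_mode_eq_zero {w : CMat p 2 → ℂ}
    (hw : ∀ v : Fin 2 → ZMod p, v ≠ 0 → ∀ x : Fin 2 → ZMod p,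
      (∑ s : CMat p 2, (if s.mulVec v = x then w s else 0)) = 0)
    (M : CMat p 2) (hM : M.rank ≤ 1) : ∑ s : CMat p 2, w s * ZMod.stdAddChar (Matrix.trace (M * s)) = 0 := by
  by_cases hM0 : M = 0
  · subst hM0
    simp_rw [zero_mul, Matrix.trace_zero, AddChar.map_zero_eq_one, mul_one]
    exact fibreGhost_total_eq_zero hw
  · obtain ⟨a, b, ha, rfl⟩ := exists_vecMulVec_of_rank_le_one M hM hM0
    simp_rw [trace_vecMulVec_mul]
    rw [sum_mul_apply_mulVec w a (fun x => ZMod.stdAddChar (b ⬝ᵥ x))]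
    refine Finset.sum_eq_zero fun x _ => ?_
    rw [hw a ha x, mul_zero]

/-- **FIBRE-GHOST SUMS VANISH ON LEVEL ONE**: for a rank-`≤ 1`-supported table `c`,
`Σ_s w(s) f_c(s) = 0`. -/
theorem fibreGhost_sum_eq_zero {w : CMat p 2 → ℂ}
    (hw : ∀ v : Fin 2 → ZMod p, v ≠ 0 → ∀ x : Fin 2 → ZMod p,
      (∑ s : CMat p 2, (if s.mulVec v = x then w s else 0)) = 0)
    (c : CMat p 2 → ℂ) (hc : ∀ M : CMat p 2, 1 < M.rank → c M = 0) :
    ∑ s : CMat p 2, w s * fourierMat c s = 0 := by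
  unfold fourierMat
  simp_rw [Finset.mul_sum]
  rw [Finset.sum_comm]
  refine Finset.sum_eq_zero fun M _ => ?_
  have hre : ∀ s : CMat p 2, w s * (c M * ZMod.stdAddChar (Matrix.trace (M * s))) =
      c M * (w s * ZMod.stdAddChar (Matrix.trace (M * s))) := fun s => by ring
  simp_rw [hre]
  rw [← Finset.mul_sum]
  by_cases hM : M.rank ≤ 1
  · rw [fibreGhost_mode_eq_zero hw M hM, mul_zero]
  · rw [hc M (by omega), zero_mul]

/-- **NO LEVEL-ONE IDENTITY TEST IN THE PRESENCE OF A FIBRE GHOST.**  Let `S ⊆ M₂(𝔽_p)` and let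
`w` be a fibre ghost supported in `S` with `w(1) ≠ 0`.  Then no rank-`≤ 1`-supported `c` has
`f_c(1) = 1` and `f_c = 0` on `S ∖ {1}`. -/
theorem no_idTest_of_fibreGhost (S : Set (CMat p 2)) (w : CMat p 2 → ℂ)
    (hsupp : ∀ s, w s ≠ 0 → s ∈ S)
    (hw : ∀ v : Fin 2 → ZMod p, v ≠ 0 → ∀ x : Fin 2 → ZMod p,
      (∑ s : CMat p 2, (if s.mulVec v = x then w s else 0)) = 0)
    (h1 : w 1 ≠ 0)
    (c : CMat p 2 → ℂ) (hc : ∀ M : CMat p 2, 1 < M.rank → c M = 0)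
    (hf1 : fourierMat c 1 = 1) (hf0 : ∀ s ∈ S, s ≠ 1 → fourierMat c s = 0) : False := by
  have hval : ∀ s : CMat p 2, w s * fourierMat c s = if s = 1 then w 1 else 0 := by
    intro s
    split_ifs with h
    · rw [h, hf1, mul_one]
    · by_cases hws : w s = 0
      · rw [hws, zero_mul]
      · rw [hf0 s (hsupp s hws) h, mul_zero]
  have hsum := fibreGhost_sum_eq_zero hw c hc
  simp_rw [hval] at hsum
  rw [Finset.sum_ite_eq' Finset.univ (1 : CMat p 2) (fun _ => w 1), if_pos (Finset.mem_univ _)] at hsum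
  exact h1 hsum

/-- **The crux-language form.**  If a fibre ghost `w` on `M₂(𝔽_p)` with `w(1) ≠ 0` is supported on the
triple products `a b g` (`a ∈ H₁, b ∈ H₂, g ∈ H₃`) of three subgroups of `GL₂(𝔽_p)`, then the
identity-design clause of `SubgroupIdentityDesigns` fails at `m = 2`, `k = 1` for `(H₁, H₂, H₃)`.
Every FAIL verdict of the gen-7 census is an explicit integer-valued `w` of this kind. -/
theorem no_levelOne_design_of_fibreGhost {H₁ H₂ H₃ : Subgroup (GLm p 2)} (w : Mat p 2 → ℂ)
    (hsupp : ∀ s, w s ≠ 0 → ∃ a ∈ H₁, ∃ b ∈ H₂, ∃ g ∈ H₃, ((a * b * g : GLm p 2) : Mat p 2) = s)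
    (hw : ∀ v : Fin 2 → ZMod p, v ≠ 0 → ∀ x : Fin 2 → ZMod p,
      (∑ s : Mat p 2, (if s.mulVec v = x then w s else 0)) = 0)
    (h1 : w 1 ≠ 0) :
    ¬ ∃ c : Matrix (Fin 2) (Fin 2) (ZMod p) → ℂ, (∀ M, 1 < M.rank → c M = 0) ∧
      (∑ M, c M * ZMod.stdAddChar (Matrix.trace (M * ((1 : GLm p 2) : Mat p 2)))) = 1 ∧
      ∀ a ∈ H₁, ∀ b ∈ H₂, ∀ g ∈ H₃, a * b * g ≠ 1 →
        (∑ M, c M * ZMod.stdAddChar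
          (Matrix.trace (M * ((a * b * g : GLm p 2) : Mat p 2)))) = 0 := by
  rintro ⟨c, hc, hc1, hc0⟩
  set S : Set (CMat p 2) :=
    {s | ∃ a ∈ H₁, ∃ b ∈ H₂, ∃ g ∈ H₃, s = ((a * b * g : GLm p 2) : Mat p 2)} with hS_def
  have hS : ∀ s, w s ≠ 0 → s ∈ S := by
    intro s hws
    obtain ⟨a, ha, b, hb, g, hg, hs⟩ := hsupp s hws
    exact ⟨a, ha, b, hb, g, hg, hs.symm⟩
  have hf1 : fourierMat c 1 = 1 := by simpa [fourierMat] using hc1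
  have hf0 : ∀ s ∈ S, s ≠ 1 → fourierMat c s = 0 := by
    rintro s ⟨a, ha, b, hb, g, hg, rfl⟩ hs1
    have hne : a * b * g ≠ 1 := fun h => hs1 (by rw [h, Units.val_one])
    simpa [fourierMat] using hc0 a ha b hb g hg hne
  exact no_idTest_of_fibreGhost S w hS hw h1 c hc hf1 hf0

end FibreGhost

end Summit.MatrixMultiplication.MatrixMultiplication.Theorems.SubgroupIdentityDesigns.Negative
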